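import Literature.Geometry.Symplectic.SphereCRSolutionRegularity
import Literature.Geometry.Symplectic.SphereCRJetMaps
import Literature.Geometry.Symplectic.SphereCROperatorGlobal
import Literature.Analysis.Complex.RiemannSphereLocalRegularityLift
import Literature.Analysis.FunctionSpaces.ContDiffHolderLocalToGlobal
import HarnessLib

/-!
# Solutions of the chart Cauchy–Riemann equations: all Hölder levels, smooth representatives

Layer B7a (section form) of the analytic core of the Hofer–Lizan–Sikorav local foliation theorem
(Wendl 2018, Thm. 2.46 / Prop. 2.53), as used by the lead of crux `WitnessCharge` (summit
`SmoothPoincare4`). The unknown of the deformation problem is a pair `y = (ξ, f) : SecPair k r`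
of Hölder sections over the Riemann sphere `S² = ℂ_z ∪ ℂ_w`, `w = z⁻¹`
(`SphereCRJetMaps.lean`): a vector field `ξ` (clutching `τ w = -w²`) and a function `f`
(clutching `τ = 1`), both of class `C^{k+1,r}`, with chart representatives
`ξ⁰ = sec₀ (-·²) ξ`, `ξ¹ = sec₁ (-·²) ξ`, `f⁰ = sec₀ 1 f`, `f¹ = sec₁ 1 f`
(`RiemannSphereHolderSections.lean`). Suppose (`0 < r < 1`) that on both discs of radius `3`
the representatives stay in the exponential chart (`den ≠ 0`) and solve the chart Cauchy–Riemann
equations `crExpr J₀ (vmap₀ ξ⁰ f⁰) = 0` (`‖z‖ < 3`), `crExpr J₁ (vmap₁ ξ¹ f¹) = 0` (`‖w‖ < 3`)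
(`SphereCROperatorPointwise.lean`). Then

* `memContDiffHolder_pieces_of_sol` — the four pieces `ξ.1, ξ.2, f.1, f.2` belong to
  `C^{m,r}_b(ℂ, ℂ)` for every `m`;
* `contDiff_sec_of_sol` — the four representatives `ξ⁰, ξ¹, f⁰, f¹` are `C^∞`;
* `memContDiffHolder_pieces_of_sol_of_norm_lt`, `contDiff_sec_of_sol_of_norm_lt` — the same
  with the smallness hypotheses `‖ξ⁰‖, ‖ξ¹‖ < 2` on the discs in place of `den ≠ 0`
  (`den_ne_zero_of_norm_lt_two`).

Proof. The representatives of any member of `𝓗^{k,r}_τ` are of local class `C^{k,r}` at every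
point (`locHolder_sec₀`, `locHolder_sec₁`: the piece itself on the disc `‖z‖ < 2`, the
transported other piece on `‖z‖ > 1/2`, `exists_memContDiffHolder_smul_comp_inv`). The chartwise
elliptic regularity `locHolder_of_crExpr_vmap₀_eq_zero` (`SphereCRSolutionRegularity.lean`;
McDuff–Salamon 2012, Thm. B.4.1), applied to `𝒥` on the `z`-disc and to the swapped data
`𝒥.swap` on the `w`-disc, upgrades this to every local class `C^{m,r}` on the two discs of radius
`3` (`locHolder_sec₀_of_sol`, `locHolder_sec₁_of_sol`), and the local-to-global lift
`memContDiffHolder_pieces_of_forall_exists` (`RiemannSphereLocalRegularityLift.lean`) returns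
the pieces. Smoothness of the representatives follows levelwise, since the representatives only
depend on the underlying functions of the pieces (`contDiff_sec₀_of_memContDiffHolder`).

## References

* D. McDuff, D. Salamon, *J-holomorphic Curves and Symplectic Topology*, 2nd ed. (2012), App. B.4,
  Thm. B.4.1. [McDuffSalamon2012]
* C. Wendl, *Holomorphic Curves in Low Dimensions*, LNM 2216 (2018), §2.3, Thm. 2.46. [Wendl2018]
* D. D. Joyce, *Riemannian Holonomy Groups and Calibrated Geometry* (2007), §1.2. [Joyce2007]
-/

noncomputable section

open Complex Set Filter Function
open scoped Topology NNReal ContDiff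
open Literature.Analysis.Complex Literature.Analysis.Complex.RiemannSphere
  Literature.Analysis.Complex.ProjectiveLineExpChart Literature.Analysis.FunctionSpaces
  Literature.Geometry.Symplectic.CRExpression

namespace Literature.Geometry.Symplectic

namespace SphereCR

/-! ### Local Hölder classes of the chart representatives of a member -/

section LocHolderSec

variable {F : Type} [NormedAddCommGroup F] [NormedSpace ℂ F] {τ : ℂ → ℂ} {k : ℕ} {r : ℝ≥0}
  {p : ContDiffHolderFunction ℂ F k r × ContDiffHolderFunction ℂ F k r}

/-- **The `z`-representative of a member of `𝓗^{k,r}_τ` is of local class `C^{k,r}` at every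
point** (`r ≤ 1`, `τ` smooth and zero-free off the origin): it is the first piece near every
point of the disc `‖z‖ < 2`, and the transported second piece `(τ z⁻¹)⁻¹ • g₁ z⁻¹` near every
point with `‖z‖ > 1/2`. [cite: Joyce2007, §1.2] -/
theorem locHolder_sec₀ (hr : r ≤ 1) (hp : p ∈ holderSections F τ k r)
    (hτ : ∀ w, w ≠ 0 → τ w ≠ 0) (hτs : ContDiffOn ℝ ∞ τ {w | w ≠ 0}) (z₀ : ℂ) :
    ∃ W, MemContDiffHolder k r W ∧ W =ᶠ[𝓝 z₀] sec₀ τ p := by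
  by_cases h2 : ‖z₀‖ < 2
  · refine ⟨p.1, p.1.memContDiffHolder, ?_⟩
    filter_upwards [(isOpen_lt continuous_norm continuous_const).mem_nhds h2] with z hz
    exact (sec₀_of_norm_lt hz).symm
  · have hz₀ : 2⁻¹ < ‖z₀‖ := lt_of_lt_of_le (by norm_num) (not_lt.1 h2)
    have hz₀0 : z₀ ≠ 0 := ne_zero_of_half_le_norm hz₀.le
    obtain ⟨W, hW, hWeq⟩ := exists_memContDiffHolder_smul_comp_inv hr (inv_ne_zero hz₀0)
      ⟨p.2, p.2.memContDiffHolder, EventuallyEq.rfl⟩ (contDiffOn_inv_tau_inv hτ hτs)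
    rw [inv_inv] at hWeq
    refine ⟨W, hW, hWeq.trans ?_⟩
    filter_upwards [(isOpen_lt continuous_const continuous_norm).mem_nhds hz₀] with z hz
    exact (sec₀_of_half_lt hp hz).symm

/-- **The `w`-representative of a member of `𝓗^{k,r}_τ` is of local class `C^{k,r}` at every
point** (symmetrically, through `sec₁ w = τ w • g₀ w⁻¹` for `‖w‖ > 1/2`).
[cite: Joyce2007, §1.2] -/
theorem locHolder_sec₁ (hr : r ≤ 1) (hp : p ∈ holderSections F τ k r)
    (hτs : ContDiffOn ℝ ∞ τ {w | w ≠ 0}) (w₀ : ℂ) :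
    ∃ W, MemContDiffHolder k r W ∧ W =ᶠ[𝓝 w₀] sec₁ τ p := by
  by_cases h2 : ‖w₀‖ < 2
  · refine ⟨p.2, p.2.memContDiffHolder, ?_⟩
    filter_upwards [(isOpen_lt continuous_norm continuous_const).mem_nhds h2] with w hw
    exact (sec₁_of_norm_lt hw).symm
  · have hw₀ : 2⁻¹ < ‖w₀‖ := lt_of_lt_of_le (by norm_num) (not_lt.1 h2)
    have hw₀0 : w₀ ≠ 0 := ne_zero_of_half_le_norm hw₀.le
    obtain ⟨W, hW, hWeq⟩ := exists_memContDiffHolder_smul_comp_inv hr (inv_ne_zero hw₀0)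
      ⟨p.1, p.1.memContDiffHolder, EventuallyEq.rfl⟩ hτs
    rw [inv_inv] at hWeq
    refine ⟨W, hW, hWeq.trans ?_⟩
    filter_upwards [(isOpen_lt continuous_const continuous_norm).mem_nhds hw₀] with w hw
    exact (sec₁_of_half_lt hp hw).symm

/-- **Smoothness of the `z`-representative from its pieces**: if both pieces of a member of
`𝓗^{k,r}_τ` belong to `C^{n,r}_b`, its `z`-representative is `C^n` (the representative only
depends on the underlying functions of the pieces: `contDiff_sec₀` at level `n`). [folklore] -/
theorem contDiff_sec₀_of_memContDiffHolder (hp : p ∈ holderSections F τ k r)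
    (hτ : ∀ w, w ≠ 0 → τ w ≠ 0) (hτs : ContDiffOn ℝ ∞ τ {w | w ≠ 0}) {n : ℕ}
    (h₁ : MemContDiffHolder n r (p.1 : ℂ → F)) (h₂ : MemContDiffHolder n r (p.2 : ℂ → F)) :
    ContDiff ℝ n (sec₀ τ p) :=
  contDiff_sec₀ (p := ((⟨_, h₁⟩ : ContDiffHolderFunction ℂ F n r),
    (⟨_, h₂⟩ : ContDiffHolderFunction ℂ F n r)))
    (show _ ∈ holderSections F τ n r from ⟨fun z hz => hp.1 z hz, fun w hw => hp.2 w hw⟩) hτ hτs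

/-- **Smoothness of the `w`-representative from its pieces.** [folklore] -/
theorem contDiff_sec₁_of_memContDiffHolder (hp : p ∈ holderSections F τ k r)
    (hτs : ContDiffOn ℝ ∞ τ {w | w ≠ 0}) {n : ℕ}
    (h₁ : MemContDiffHolder n r (p.1 : ℂ → F)) (h₂ : MemContDiffHolder n r (p.2 : ℂ → F)) :
    ContDiff ℝ n (sec₁ τ p) :=
  contDiff_sec₁ (p := ((⟨_, h₁⟩ : ContDiffHolderFunction ℂ F n r),
    (⟨_, h₂⟩ : ContDiffHolderFunction ℂ F n r)))
    (show _ ∈ holderSections F τ n r from ⟨fun z hz => hp.1 z hz, fun w hw => hp.2 w hw⟩) hτs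

end LocHolderSec

namespace SphereACData

variable (𝒥 : SphereACData) {k : ℕ} {r : ℝ≥0}

/-! ### Local classes of a solution on the two discs -/

/-- **All local Hölder classes of a solution on the `z`-disc.** For `y = (ξ, f) : SecPair k r`
whose `z`-representatives `ξ⁰ = sec₀ (-·²) ξ`, `f⁰ = sec₀ 1 f` stay in the exponential chart and
solve `crExpr J₀ (vmap₀ ξ⁰ f⁰) = 0` on the disc `‖z‖ < 3` (`0 < r < 1`), `ξ⁰` and `f⁰` are of local
class `C^{m,r}` near every point of that disc, for every `m` (the representatives are of local
class `C^{k+1,r} ⊆ C^{1,r}` everywhere, `locHolder_sec₀`; then elliptic regularity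
`locHolder_of_crExpr_vmap₀_eq_zero`). [cite: McDuffSalamon2012, Thm B.4.1] -/
theorem locHolder_sec₀_of_sol (hr0 : 0 < r) (hr1 : r < 1) (y : SecPair k r)
    (hden₀ : ∀ z : ℂ, ‖z‖ < 3 → den z (sec₀ (fun w : ℂ => -w ^ 2) y.1.1 z) ≠ 0)
    (hsol₀ : ∀ z : ℂ, ‖z‖ < 3 →
      crExpr 𝒥.J₀ (𝒥.vmap₀ (sec₀ (fun w : ℂ => -w ^ 2) y.1.1) (sec₀ (1 : ℂ → ℂ) y.2.1)) z = 0)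
    (m : ℕ) {z₀ : ℂ} (hz₀ : ‖z₀‖ < 3) :
    (∃ W : ℂ → ℂ, MemContDiffHolder m r W ∧ W =ᶠ[𝓝 z₀] sec₀ (fun w : ℂ => -w ^ 2) y.1.1) ∧
      ∃ W : ℂ → ℂ, MemContDiffHolder m r W ∧ W =ᶠ[𝓝 z₀] sec₀ (1 : ℂ → ℂ) y.2.1 := by
  have hr : r ≤ 1 := hr1.le
  have hξ : ∃ W : ℂ → ℂ, MemContDiffHolder 1 r W ∧
      W =ᶠ[𝓝 z₀] sec₀ (fun w : ℂ => -w ^ 2) y.1.1 :=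
    locHolder_of_le hr (Nat.le_add_left 1 k)
      (locHolder_sec₀ hr y.1.2 neg_sq_clutch_ne_zero contDiffOn_neg_sq_clutch z₀)
  have hf : ∃ W : ℂ → ℂ, MemContDiffHolder 1 r W ∧ W =ᶠ[𝓝 z₀] sec₀ (1 : ℂ → ℂ) y.2.1 :=
    locHolder_of_le hr (Nat.le_add_left 1 k)
      (locHolder_sec₀ hr y.2.2 one_clutch_ne_zero contDiffOn_one_clutch z₀)
  have hsol : ∀ᶠ z in 𝓝 z₀,
      crExpr 𝒥.J₀ (𝒥.vmap₀ (sec₀ (fun w : ℂ => -w ^ 2) y.1.1) (sec₀ (1 : ℂ → ℂ) y.2.1)) z = 0 := by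
    filter_upwards [(isOpen_lt continuous_norm continuous_const).mem_nhds hz₀] with z hz
    exact hsol₀ z hz
  exact 𝒥.locHolder_of_crExpr_vmap₀_eq_zero hr0 hr1 hξ hf (hden₀ z₀ hz₀) hsol m

/-- **All local Hölder classes of a solution on the `w`-disc** (the same for the
`w`-representatives `ξ¹ = sec₁ (-·²) ξ`, `f¹ = sec₁ 1 f` and the chart-`1` equation
`crExpr J₁ (vmap₁ ξ¹ f¹) = 0` on `‖w‖ < 3`, through the swapped data `𝒥.swap`).
[cite: McDuffSalamon2012, Thm B.4.1] -/
theorem locHolder_sec₁_of_sol (hr0 : 0 < r) (hr1 : r < 1) (y : SecPair k r)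
    (hden₁ : ∀ w : ℂ, ‖w‖ < 3 → den w (sec₁ (fun w : ℂ => -w ^ 2) y.1.1 w) ≠ 0)
    (hsol₁ : ∀ w : ℂ, ‖w‖ < 3 →
      crExpr 𝒥.J₁ (𝒥.vmap₁ (sec₁ (fun w : ℂ => -w ^ 2) y.1.1) (sec₁ (1 : ℂ → ℂ) y.2.1)) w = 0)
    (m : ℕ) {w₀ : ℂ} (hw₀ : ‖w₀‖ < 3) :
    (∃ W : ℂ → ℂ, MemContDiffHolder m r W ∧ W =ᶠ[𝓝 w₀] sec₁ (fun w : ℂ => -w ^ 2) y.1.1) ∧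
      ∃ W : ℂ → ℂ, MemContDiffHolder m r W ∧ W =ᶠ[𝓝 w₀] sec₁ (1 : ℂ → ℂ) y.2.1 := by
  have hr : r ≤ 1 := hr1.le
  have hξ : ∃ W : ℂ → ℂ, MemContDiffHolder 1 r W ∧
      W =ᶠ[𝓝 w₀] sec₁ (fun w : ℂ => -w ^ 2) y.1.1 :=
    locHolder_of_le hr (Nat.le_add_left 1 k) (locHolder_sec₁ hr y.1.2 contDiffOn_neg_sq_clutch w₀)
  have hf : ∃ W : ℂ → ℂ, MemContDiffHolder 1 r W ∧ W =ᶠ[𝓝 w₀] sec₁ (1 : ℂ → ℂ) y.2.1 :=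
    locHolder_of_le hr (Nat.le_add_left 1 k) (locHolder_sec₁ hr y.2.2 contDiffOn_one_clutch w₀)
  have hsol : ∀ᶠ w in 𝓝 w₀, crExpr 𝒥.swap.J₀
      (𝒥.swap.vmap₀ (sec₁ (fun w : ℂ => -w ^ 2) y.1.1) (sec₁ (1 : ℂ → ℂ) y.2.1)) w = 0 := by
    filter_upwards [(isOpen_lt continuous_norm continuous_const).mem_nhds hw₀] with w hw
    exact hsol₁ w hw
  exact 𝒥.swap.locHolder_of_crExpr_vmap₀_eq_zero hr0 hr1 hξ hf (hden₁ w₀ hw₀) hsol m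

/-! ### All Hölder levels of the pieces -/

/-- **The pieces of a solution are in every `C^{m,r}_b`.** Let `0 < r < 1` and let
`y = (ξ, f) : SecPair k r` have representatives `ξ⁰, f⁰` (chart `z`) and `ξ¹, f¹` (chart `w`) which
stay in the exponential chart and solve the chart Cauchy–Riemann equations
`crExpr J₀ (vmap₀ ξ⁰ f⁰) = 0` on `‖z‖ < 3` and `crExpr J₁ (vmap₁ ξ¹ f¹) = 0` on `‖w‖ < 3`. Then the
four pieces `ξ.1, ξ.2, f.1, f.2 : C^{k+1,r}_b(ℂ, ℂ)` belong to `C^{m,r}_b(ℂ, ℂ)` for every `m`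
(chartwise elliptic regularity on the two discs, `locHolder_sec₀_of_sol` / `locHolder_sec₁_of_sol`,
lifted by `memContDiffHolder_pieces_of_forall_exists`). [cite: McDuffSalamon2012, Thm B.4.1] -/
theorem memContDiffHolder_pieces_of_sol (hr0 : 0 < r) (hr1 : r < 1) (y : SecPair k r)
    (hden₀ : ∀ z : ℂ, ‖z‖ < 3 → den z (sec₀ (fun w : ℂ => -w ^ 2) y.1.1 z) ≠ 0)
    (hden₁ : ∀ w : ℂ, ‖w‖ < 3 → den w (sec₁ (fun w : ℂ => -w ^ 2) y.1.1 w) ≠ 0)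
    (hsol₀ : ∀ z : ℂ, ‖z‖ < 3 →
      crExpr 𝒥.J₀ (𝒥.vmap₀ (sec₀ (fun w : ℂ => -w ^ 2) y.1.1) (sec₀ (1 : ℂ → ℂ) y.2.1)) z = 0)
    (hsol₁ : ∀ w : ℂ, ‖w‖ < 3 →
      crExpr 𝒥.J₁ (𝒥.vmap₁ (sec₁ (fun w : ℂ => -w ^ 2) y.1.1) (sec₁ (1 : ℂ → ℂ) y.2.1)) w = 0)
    (m : ℕ) :
    MemContDiffHolder m r (y.1.1.1 : ℂ → ℂ) ∧ MemContDiffHolder m r (y.1.1.2 : ℂ → ℂ) ∧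
      MemContDiffHolder m r (y.2.1.1 : ℂ → ℂ) ∧ MemContDiffHolder m r (y.2.1.2 : ℂ → ℂ) := by
  have hT := memContDiffHolder_pieces_of_forall_exists (m := m) hr1.le neg_sq_clutch_ne_zero
    contDiffOn_neg_sq_clutch y.1
    (fun z hz => (𝒥.locHolder_sec₀_of_sol hr0 hr1 y hden₀ hsol₀ m hz).1)
    (fun w hw => (𝒥.locHolder_sec₁_of_sol hr0 hr1 y hden₁ hsol₁ m hw).1)
  have hN := memContDiffHolder_pieces_of_forall_exists (m := m) hr1.le one_clutch_ne_zero
    contDiffOn_one_clutch y.2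
    (fun z hz => (𝒥.locHolder_sec₀_of_sol hr0 hr1 y hden₀ hsol₀ m hz).2)
    (fun w hw => (𝒥.locHolder_sec₁_of_sol hr0 hr1 y hden₁ hsol₁ m hw).2)
  exact ⟨hT.1, hT.2, hN.1, hN.2⟩

/-! ### Smoothness of the representatives -/

/-- **The representatives of a solution are `C^∞`.** Under the hypotheses of
`memContDiffHolder_pieces_of_sol`, the four chart representatives `ξ⁰ = sec₀ (-·²) ξ`,
`ξ¹ = sec₁ (-·²) ξ`, `f⁰ = sec₀ 1 f`, `f¹ = sec₁ 1 f` are `C^∞` on all of `ℂ` (levelwise from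
`memContDiffHolder_pieces_of_sol`: the representatives of a member whose pieces are in
`C^{n,r}_b` are `C^n`). [cite: McDuffSalamon2012, Thm B.4.1] -/
theorem contDiff_sec_of_sol (hr0 : 0 < r) (hr1 : r < 1) (y : SecPair k r)
    (hden₀ : ∀ z : ℂ, ‖z‖ < 3 → den z (sec₀ (fun w : ℂ => -w ^ 2) y.1.1 z) ≠ 0)
    (hden₁ : ∀ w : ℂ, ‖w‖ < 3 → den w (sec₁ (fun w : ℂ => -w ^ 2) y.1.1 w) ≠ 0)
    (hsol₀ : ∀ z : ℂ, ‖z‖ < 3 →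
      crExpr 𝒥.J₀ (𝒥.vmap₀ (sec₀ (fun w : ℂ => -w ^ 2) y.1.1) (sec₀ (1 : ℂ → ℂ) y.2.1)) z = 0)
    (hsol₁ : ∀ w : ℂ, ‖w‖ < 3 →
      crExpr 𝒥.J₁ (𝒥.vmap₁ (sec₁ (fun w : ℂ => -w ^ 2) y.1.1) (sec₁ (1 : ℂ → ℂ) y.2.1)) w = 0) :
    ContDiff ℝ ∞ (sec₀ (fun w : ℂ => -w ^ 2) y.1.1) ∧
      ContDiff ℝ ∞ (sec₁ (fun w : ℂ => -w ^ 2) y.1.1) ∧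
      ContDiff ℝ ∞ (sec₀ (1 : ℂ → ℂ) y.2.1) ∧ ContDiff ℝ ∞ (sec₁ (1 : ℂ → ℂ) y.2.1) := by
  have h := fun n : ℕ => 𝒥.memContDiffHolder_pieces_of_sol hr0 hr1 y hden₀ hden₁ hsol₀ hsol₁ n
  refine ⟨contDiff_infty.2 fun n => ?_, contDiff_infty.2 fun n => ?_,
    contDiff_infty.2 fun n => ?_, contDiff_infty.2 fun n => ?_⟩
  · exact contDiff_sec₀_of_memContDiffHolder y.1.2 neg_sq_clutch_ne_zero contDiffOn_neg_sq_clutch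
      (h n).1 (h n).2.1
  · exact contDiff_sec₁_of_memContDiffHolder y.1.2 contDiffOn_neg_sq_clutch (h n).1 (h n).2.1
  · exact contDiff_sec₀_of_memContDiffHolder y.2.2 one_clutch_ne_zero contDiffOn_one_clutch
      (h n).2.2.1 (h n).2.2.2
  · exact contDiff_sec₁_of_memContDiffHolder y.2.2 contDiffOn_one_clutch (h n).2.2.1 (h n).2.2.2

/-! ### Variants: staying in the chart from smallness -/

/-- **The pieces of a small solution are in every `C^{m,r}_b`**: as
`memContDiffHolder_pieces_of_sol`, with the chart condition `den ≠ 0` replaced by the smallness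
`‖ξ⁰ z‖ < 2` (`‖z‖ < 3`), `‖ξ¹ w‖ < 2` (`‖w‖ < 3`) of the tangent representatives
(`den_ne_zero_of_norm_lt_two`). [cite: McDuffSalamon2012, Thm B.4.1] -/
theorem memContDiffHolder_pieces_of_sol_of_norm_lt (hr0 : 0 < r) (hr1 : r < 1) (y : SecPair k r)
    (hξ₀ : ∀ z : ℂ, ‖z‖ < 3 → ‖sec₀ (fun w : ℂ => -w ^ 2) y.1.1 z‖ < 2)
    (hξ₁ : ∀ w : ℂ, ‖w‖ < 3 → ‖sec₁ (fun w : ℂ => -w ^ 2) y.1.1 w‖ < 2)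
    (hsol₀ : ∀ z : ℂ, ‖z‖ < 3 →
      crExpr 𝒥.J₀ (𝒥.vmap₀ (sec₀ (fun w : ℂ => -w ^ 2) y.1.1) (sec₀ (1 : ℂ → ℂ) y.2.1)) z = 0)
    (hsol₁ : ∀ w : ℂ, ‖w‖ < 3 →
      crExpr 𝒥.J₁ (𝒥.vmap₁ (sec₁ (fun w : ℂ => -w ^ 2) y.1.1) (sec₁ (1 : ℂ → ℂ) y.2.1)) w = 0)
    (m : ℕ) :
    MemContDiffHolder m r (y.1.1.1 : ℂ → ℂ) ∧ MemContDiffHolder m r (y.1.1.2 : ℂ → ℂ) ∧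
      MemContDiffHolder m r (y.2.1.1 : ℂ → ℂ) ∧ MemContDiffHolder m r (y.2.1.2 : ℂ → ℂ) :=
  𝒥.memContDiffHolder_pieces_of_sol hr0 hr1 y (fun z hz => den_ne_zero_of_norm_lt_two (hξ₀ z hz))
    (fun w hw => den_ne_zero_of_norm_lt_two (hξ₁ w hw)) hsol₀ hsol₁ m

/-- **The representatives of a small solution are `C^∞`**: as `contDiff_sec_of_sol`, with the
chart condition replaced by the smallness `‖ξ⁰‖, ‖ξ¹‖ < 2` on the discs of radius `3`.
[cite: McDuffSalamon2012, Thm B.4.1] -/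
theorem contDiff_sec_of_sol_of_norm_lt (hr0 : 0 < r) (hr1 : r < 1) (y : SecPair k r)
    (hξ₀ : ∀ z : ℂ, ‖z‖ < 3 → ‖sec₀ (fun w : ℂ => -w ^ 2) y.1.1 z‖ < 2)
    (hξ₁ : ∀ w : ℂ, ‖w‖ < 3 → ‖sec₁ (fun w : ℂ => -w ^ 2) y.1.1 w‖ < 2)
    (hsol₀ : ∀ z : ℂ, ‖z‖ < 3 →
      crExpr 𝒥.J₀ (𝒥.vmap₀ (sec₀ (fun w : ℂ => -w ^ 2) y.1.1) (sec₀ (1 : ℂ → ℂ) y.2.1)) z = 0)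
    (hsol₁ : ∀ w : ℂ, ‖w‖ < 3 →
      crExpr 𝒥.J₁ (𝒥.vmap₁ (sec₁ (fun w : ℂ => -w ^ 2) y.1.1) (sec₁ (1 : ℂ → ℂ) y.2.1)) w = 0) :
    ContDiff ℝ ∞ (sec₀ (fun w : ℂ => -w ^ 2) y.1.1) ∧
      ContDiff ℝ ∞ (sec₁ (fun w : ℂ => -w ^ 2) y.1.1) ∧
      ContDiff ℝ ∞ (sec₀ (1 : ℂ → ℂ) y.2.1) ∧ ContDiff ℝ ∞ (sec₁ (1 : ℂ → ℂ) y.2.1) :=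
  𝒥.contDiff_sec_of_sol hr0 hr1 y (fun z hz => den_ne_zero_of_norm_lt_two (hξ₀ z hz))
    (fun w hw => den_ne_zero_of_norm_lt_two (hξ₁ w hw)) hsol₀ hsol₁

end SphereACData

end SphereCR

end Literature.Geometry.Symplectic

end
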